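import Literature.Probability.LatticeModels.TorusFourierProofs
import Mathlib.Data.ZMod.ValMinAbs
import Mathlib.LinearAlgebra.Matrix.NonsingularInverse
import Mathlib.Data.Int.Interval
import HarnessLib

/-!
# Counting torus momenta in a rotated rectangle (the phase space of an anisotropic sector at finite `L`)

Topic `Literature/Probability/LatticeModels`.  The single-scale sector propagators of a two-dimensional lattice
fermion model are supported, in momentum space, in ROTATED rectangles `{|⟨k - c, n⟩| ≤ B₁, |⟨k - c, τ⟩| ≤ B₂}`
(`(n, τ)` the normal / tangent frame at a point of the Fermi curve, `B₁ = O(γ^h)`, `B₂ = O(γ^{h/2})`;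
Benfatto–Giuliani–Mastropietro 2006, §2.5 (2.46)–(2.50)).  In infinite volume the dimensional bound (2.50) is the
AREA `4B₁B₂` of the box; on the torus `(ℤ/Lℤ)²` with momenta `2πk̃/L`, `k̃ ∈ (-L/2, L/2]²` the minimal
representatives, it is the NUMBER of momenta in the box, which for `L ≫ B₂⁻¹` is again `≍ L² B₁ B₂/π²` — and not the
`L² B₂²` of the axis-parallel bounding box.  This file proves the counting estimate by a purely combinatorial
argument (the floor coordinates in the rotated frame at resolution `√2 π/L` are injective, since distinct torus momenta
are `2π/L` apart):

* `frame_sq_add_sq_eq` — completeness of an orthonormal frame of the plane: `⟨u,n⟩² + ⟨u,τ⟩² = u₀² + u₁²`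
  (`mul_eq_one_comm` for the frame matrix);
* `valMinAbs_eq_of_abs_sub_lt` — minimal representatives at real distance `< 1` are equal;
* `card_filter_abs_le_le_of_separated` — the abstract count: if `|X a - X b| < δ` and `|Y a - Y b| < δ` force `a = b`,
  then `#{|X| ≤ B₁, |Y| ≤ B₂} ≤ (2B₁/δ + 2)(2B₂/δ + 2)` (floor coordinates);
* `eq_of_frame_coords_lt` — two torus momenta whose frame coordinates differ by less than `√2 π/L` are equal;
* **`card_filter_momenta_frameBox_le`** — `#{k : |⟨2πk̃/L - c, n⟩| ≤ B₁, |⟨2πk̃/L - c, τ⟩| ≤ B₂} ≤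
  (√2 L B₁/π + 2)(√2 L B₂/π + 2)`.

Everything is proved; no definitions, no named facts. [folklore]

## Sources

G. Benfatto, A. Giuliani, V. Mastropietro, Ann. Henri Poincaré 7 (2006) 809–898, §2.5 (2.46)–(2.50) and footnote ¹
(finite `L`) (`BenfattoGiulianiMastropietro2006`).  Routine ("folklore").
-/

noncomputable section

open Finset
open scoped Real

namespace Literature.Probability.LatticeModels

/-! ### Plane geometry of an orthonormal frame -/

/-- **Completeness of an orthonormal frame of the plane**: if `|n| = |τ| = 1` and `n ⊥ τ` then
`⟨u,n⟩² + ⟨u,τ⟩² = u₀² + u₁²` for every `u`. [folklore] -/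
theorem frame_sq_add_sq_eq {n τ : Fin 2 → ℝ} (hn : n 0 ^ 2 + n 1 ^ 2 = 1) (hτ : τ 0 ^ 2 + τ 1 ^ 2 = 1)
    (hnτ : n 0 * τ 0 + n 1 * τ 1 = 0) (u : Fin 2 → ℝ) :
    (u 0 * n 0 + u 1 * n 1) ^ 2 + (u 0 * τ 0 + u 1 * τ 1) ^ 2 = u 0 ^ 2 + u 1 ^ 2 := by
  -- the frame matrix `M = [n; τ]` satisfies `M Mᵀ = 1`, hence `Mᵀ M = 1`
  set M : Matrix (Fin 2) (Fin 2) ℝ := !![n 0, n 1; τ 0, τ 1] with hM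
  have h1 : M * M.transpose = 1 := by
    ext i j
    fin_cases i <;> fin_cases j
    · simp [hM, Matrix.mul_apply, Fin.sum_univ_two]; nlinarith [hn]
    · simp [hM, Matrix.mul_apply, Fin.sum_univ_two]; nlinarith [hnτ]
    · simp [hM, Matrix.mul_apply, Fin.sum_univ_two]; nlinarith [hnτ]
    · simp [hM, Matrix.mul_apply, Fin.sum_univ_two]; nlinarith [hτ]
  have h2 : M.transpose * M = 1 := mul_eq_one_comm.1 h1
  have e00 := congrFun (congrFun h2 0) 0
  have e11 := congrFun (congrFun h2 1) 1
  have e01 := congrFun (congrFun h2 0) 1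
  simp [hM, Matrix.mul_apply, Fin.sum_univ_two] at e00 e11 e01
  linear_combination u 0 ^ 2 * e00 + u 1 ^ 2 * e11 + 2 * u 0 * u 1 * e01

/-- **Minimal representatives at real distance `< 1` coincide.** [folklore] -/
theorem valMinAbs_eq_of_abs_sub_lt {L : ℕ} (a b : ZMod L) (h : |((a.valMinAbs : ℝ)) - (b.valMinAbs : ℝ)| < 1) : a = b := by
  have hint : |a.valMinAbs - b.valMinAbs| < 1 := by exact_mod_cast h
  have heq : a.valMinAbs = b.valMinAbs := by
    have := abs_lt.1 hint
    omega
  exact ZMod.injective_valMinAbs heq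

/-! ### The abstract count by floor coordinates -/

/-- **Counting by floor coordinates**: if `|X a - X b| < δ` together with `|Y a - Y b| < δ` forces `a = b` (`δ > 0`), then
`#{a : |X a| ≤ B₁, |Y a| ≤ B₂} ≤ (2B₁/δ + 2)(2B₂/δ + 2)`. [folklore] -/
theorem card_filter_abs_le_le_of_separated {α : Type*} [Fintype α] (X Y : α → ℝ) {δ : ℝ} (hδ : 0 < δ)
    (hsep : ∀ a b, |X a - X b| < δ → |Y a - Y b| < δ → a = b) {B₁ B₂ : ℝ} (hB₁ : 0 ≤ B₁) (hB₂ : 0 ≤ B₂) :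
    (((univ.filter fun a => |X a| ≤ B₁ ∧ |Y a| ≤ B₂).card : ℕ) : ℝ) ≤ (2 * B₁ / δ + 2) * (2 * B₂ / δ + 2) := by
  classical
  set f : α → ℤ × ℤ := fun a => (⌊X a / δ⌋, ⌊Y a / δ⌋) with hf
  set S := univ.filter fun a => |X a| ≤ B₁ ∧ |Y a| ≤ B₂ with hS
  -- (1) `f` is injective
  have hinj : Function.Injective f := by
    intro a b hab
    rw [hf] at hab
    simp only [Prod.mk.injEq] at hab
    have hX : |X a / δ - X b / δ| < 1 := Int.abs_sub_lt_one_of_floor_eq_floor hab.1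
    have hY : |Y a / δ - Y b / δ| < 1 := Int.abs_sub_lt_one_of_floor_eq_floor hab.2
    rw [← sub_div, abs_div, abs_of_pos hδ, div_lt_one hδ] at hX hY
    exact hsep a b hX hY
  -- (2) the image of `S` lies in a product of integer intervals
  have himg : S.image f ⊆ (Finset.Icc ⌊-B₁ / δ⌋ ⌊B₁ / δ⌋) ×ˢ (Finset.Icc ⌊-B₂ / δ⌋ ⌊B₂ / δ⌋) := by
    intro z hz
    obtain ⟨a, ha, rfl⟩ := mem_image.1 hz
    obtain ⟨h1, h2⟩ := (mem_filter.1 ha).2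
    rw [mem_product, Finset.mem_Icc, Finset.mem_Icc]
    obtain ⟨h1l, h1r⟩ := abs_le.1 h1
    obtain ⟨h2l, h2r⟩ := abs_le.1 h2
    exact ⟨⟨Int.floor_mono (div_le_div_of_nonneg_right h1l hδ.le), Int.floor_mono (div_le_div_of_nonneg_right h1r hδ.le)⟩,
      ⟨Int.floor_mono (div_le_div_of_nonneg_right h2l hδ.le), Int.floor_mono (div_le_div_of_nonneg_right h2r hδ.le)⟩⟩
  -- (3) the integer intervals are short
  have hcardI : ∀ {B : ℝ}, 0 ≤ B → (((Finset.Icc ⌊-B / δ⌋ ⌊B / δ⌋).card : ℕ) : ℝ) ≤ 2 * B / δ + 2 := by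
    intro B hB
    rw [Int.card_Icc]
    have hfl : (⌊B / δ⌋ : ℝ) ≤ B / δ := Int.floor_le _
    have hce : (-⌊-B / δ⌋ : ℝ) ≤ B / δ + 1 := by
      rw [neg_div, Int.floor_neg, Int.cast_neg, neg_neg]
      exact (Int.ceil_lt_add_one _).le
    have h0 : (0 : ℤ) ≤ ⌊B / δ⌋ + 1 - ⌊-B / δ⌋ := by
      have : ⌊-B / δ⌋ ≤ ⌊B / δ⌋ := Int.floor_mono (div_le_div_of_nonneg_right (by linarith) hδ.le)
      omega
    have hcast : (((⌊B / δ⌋ + 1 - ⌊-B / δ⌋).toNat : ℕ) : ℝ) = (⌊B / δ⌋ : ℝ) + 1 - ⌊-B / δ⌋ := by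
      rw [show (((⌊B / δ⌋ + 1 - ⌊-B / δ⌋).toNat : ℕ) : ℝ) = (((⌊B / δ⌋ + 1 - ⌊-B / δ⌋).toNat : ℤ) : ℝ) from rfl,
        Int.toNat_of_nonneg h0]
      push_cast
      ring
    rw [hcast]
    calc (⌊B / δ⌋ : ℝ) + 1 - ⌊-B / δ⌋ ≤ B / δ + 1 + (B / δ + 1) := by linarith
      _ = 2 * B / δ + 2 := by ring
  calc ((S.card : ℕ) : ℝ) = (((S.image f).card : ℕ) : ℝ) := by rw [card_image_of_injective S hinj]
    _ ≤ ((((Finset.Icc ⌊-B₁ / δ⌋ ⌊B₁ / δ⌋) ×ˢ (Finset.Icc ⌊-B₂ / δ⌋ ⌊B₂ / δ⌋)).card : ℕ) : ℝ) := by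
        exact_mod_cast card_le_card himg
    _ = (((Finset.Icc ⌊-B₁ / δ⌋ ⌊B₁ / δ⌋).card : ℕ) : ℝ) * (((Finset.Icc ⌊-B₂ / δ⌋ ⌊B₂ / δ⌋).card : ℕ) : ℝ) := by
        rw [card_product, Nat.cast_mul]
    _ ≤ (2 * B₁ / δ + 2) * (2 * B₂ / δ + 2) := mul_le_mul (hcardI hB₁) (hcardI hB₂) (Nat.cast_nonneg _) (by positivity)

/-! ### Torus momenta -/

/-- **Two torus momenta whose frame coordinates differ by less than `√2 π/L` are equal** (distinct momenta
`2πk̃/L` are `2π/L` apart in some coordinate, hence at Euclidean distance `≥ 2π/L = √2 · √2 π/L`). [folklore] -/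
theorem eq_of_frame_coords_lt (L : ℕ) [NeZero L] {n τ : Fin 2 → ℝ} (hn : n 0 ^ 2 + n 1 ^ 2 = 1)
    (hτ : τ 0 ^ 2 + τ 1 ^ 2 = 1) (hnτ : n 0 * τ 0 + n 1 * τ 1 = 0) (k k' : TorusSite 2 L)
    (hX : |(2 * π * (((k 0).valMinAbs : ℤ) : ℝ) / L - 2 * π * (((k' 0).valMinAbs : ℤ) : ℝ) / L) * n 0 +
        (2 * π * (((k 1).valMinAbs : ℤ) : ℝ) / L - 2 * π * (((k' 1).valMinAbs : ℤ) : ℝ) / L) * n 1| < Real.sqrt 2 * π / L)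
    (hY : |(2 * π * (((k 0).valMinAbs : ℤ) : ℝ) / L - 2 * π * (((k' 0).valMinAbs : ℤ) : ℝ) / L) * τ 0 +
        (2 * π * (((k 1).valMinAbs : ℤ) : ℝ) / L - 2 * π * (((k' 1).valMinAbs : ℤ) : ℝ) / L) * τ 1| < Real.sqrt 2 * π / L) :
    k = k' := by
  have hL : (0 : ℝ) < L := Nat.cast_pos.2 (Nat.pos_of_ne_zero (NeZero.ne L))
  have hs2sq : Real.sqrt 2 ^ 2 = 2 := Real.sq_sqrt two_pos.le
  set m : Fin 2 → ℝ := fun i => (((k i).valMinAbs : ℤ) : ℝ) - (((k' i).valMinAbs : ℤ) : ℝ) with hm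
  set u : Fin 2 → ℝ := fun i => 2 * π / L * m i with hu
  have hu' : ∀ i, 2 * π * (((k i).valMinAbs : ℤ) : ℝ) / L - 2 * π * (((k' i).valMinAbs : ℤ) : ℝ) / L = u i := fun i => by
    simp only [hu, hm]; ring
  rw [hu' 0, hu' 1] at hX hY
  have hδ : 0 < Real.sqrt 2 * π / L := by positivity
  have hA : (u 0 * n 0 + u 1 * n 1) ^ 2 < (Real.sqrt 2 * π / L) ^ 2 := sq_lt_sq' (abs_lt.1 hX).1 (abs_lt.1 hX).2
  have hB : (u 0 * τ 0 + u 1 * τ 1) ^ 2 < (Real.sqrt 2 * π / L) ^ 2 := sq_lt_sq' (abs_lt.1 hY).1 (abs_lt.1 hY).2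
  have hsum : u 0 ^ 2 + u 1 ^ 2 < 2 * (Real.sqrt 2 * π / L) ^ 2 := by
    rw [← frame_sq_add_sq_eq hn hτ hnτ u]; linarith
  have h2 : 2 * (Real.sqrt 2 * π / L) ^ 2 = (2 * π / L) ^ 2 := by
    rw [div_pow, div_pow, mul_pow, hs2sq]; ring
  rw [h2] at hsum
  -- each coordinate: `(2π/L)² mᵢ² < (2π/L)²`, so `|mᵢ| < 1`
  have hcoord : ∀ i, k i = k' i := by
    intro i
    have hui : u i ^ 2 < (2 * π / L) ^ 2 := by
      have h0 : 0 ≤ u 0 ^ 2 := sq_nonneg _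
      have h1 : 0 ≤ u 1 ^ 2 := sq_nonneg _
      revert i
      rw [Fin.forall_fin_two]
      exact ⟨by linarith, by linarith⟩
    have hpos : (0 : ℝ) < (2 * π / L) ^ 2 := by positivity
    have hmi : m i ^ 2 < 1 := by
      have : (2 * π / L) ^ 2 * m i ^ 2 < (2 * π / L) ^ 2 * 1 := by
        rw [mul_one, ← mul_pow]; exact hui
      exact lt_of_mul_lt_mul_left this hpos.le
    have habs : |m i| < 1 := (sq_lt_one_iff_abs_lt_one (m i)).1 hmi
    exact valMinAbs_eq_of_abs_sub_lt (k i) (k' i) habs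
  exact funext hcoord

/-- **Counting torus momenta in a rotated rectangle** (the finite-`L` phase space of an anisotropic sector,
Benfatto–Giuliani–Mastropietro 2006, (2.46)–(2.50)): for an orthonormal frame `(n, τ)` of the plane, a centre `c` and
half-sides `B₁, B₂ ≥ 0`, the number of momenta `2πk̃/L`, `k ∈ (ℤ/Lℤ)²` (`k̃` the minimal representatives), with
`|⟨2πk̃/L - c, n⟩| ≤ B₁` and `|⟨2πk̃/L - c, τ⟩| ≤ B₂` is at most `(√2 L B₁/π + 2)(√2 L B₂/π + 2)`.
[cite: BenfattoGiulianiMastropietro2006, §2.5 (2.46)-(2.50)] -/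
theorem card_filter_momenta_frameBox_le (L : ℕ) [NeZero L] {n τ : Fin 2 → ℝ} (hn : n 0 ^ 2 + n 1 ^ 2 = 1)
    (hτ : τ 0 ^ 2 + τ 1 ^ 2 = 1) (hnτ : n 0 * τ 0 + n 1 * τ 1 = 0) (c : Fin 2 → ℝ) {B₁ B₂ : ℝ} (hB₁ : 0 ≤ B₁) (hB₂ : 0 ≤ B₂) :
    (((univ : Finset (TorusSite 2 L)).filter fun k =>
        |(2 * π * (((k 0).valMinAbs : ℤ) : ℝ) / L - c 0) * n 0 + (2 * π * (((k 1).valMinAbs : ℤ) : ℝ) / L - c 1) * n 1| ≤ B₁ ∧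
        |(2 * π * (((k 0).valMinAbs : ℤ) : ℝ) / L - c 0) * τ 0 + (2 * π * (((k 1).valMinAbs : ℤ) : ℝ) / L - c 1) * τ 1| ≤ B₂).card : ℝ) ≤
      (Real.sqrt 2 * L * B₁ / π + 2) * (Real.sqrt 2 * L * B₂ / π + 2) := by
  have hL : (0 : ℝ) < L := Nat.cast_pos.2 (Nat.pos_of_ne_zero (NeZero.ne L))
  have hs2 : (0 : ℝ) < Real.sqrt 2 := Real.sqrt_pos.2 two_pos
  have hs2sq : Real.sqrt 2 ^ 2 = 2 := Real.sq_sqrt two_pos.le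
  have hδ : 0 < Real.sqrt 2 * π / L := by positivity
  have h := card_filter_abs_le_le_of_separated
    (fun k : TorusSite 2 L => (2 * π * (((k 0).valMinAbs : ℤ) : ℝ) / L - c 0) * n 0 + (2 * π * (((k 1).valMinAbs : ℤ) : ℝ) / L - c 1) * n 1)
    (fun k : TorusSite 2 L => (2 * π * (((k 0).valMinAbs : ℤ) : ℝ) / L - c 0) * τ 0 + (2 * π * (((k 1).valMinAbs : ℤ) : ℝ) / L - c 1) * τ 1)
    hδ (fun k k' hX hY => eq_of_frame_coords_lt L hn hτ hnτ k k'
      (by convert hX using 2; ring) (by convert hY using 2; ring)) hB₁ hB₂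
  refine h.trans (le_of_eq ?_)
  have h2 : (2 : ℝ) = Real.sqrt 2 * Real.sqrt 2 := by rw [← sq, hs2sq]
  have hconst : ∀ B : ℝ, 2 * B / (Real.sqrt 2 * π / L) = Real.sqrt 2 * L * B / π := by
    intro B
    rw [div_div_eq_mul_div, div_eq_div_iff (by positivity) (by positivity)]
    linear_combination (B * L * π) * h2
  rw [hconst, hconst]

end Literature.Probability.LatticeModels
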